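/-
Copyright (c) 2026 the pub-hodgecm-mathlib formalisation cell (harness21).  Prover seat hodgecm-mathlib-R90-C14-p01 (g0), R90-TF section S8 «ContSpec-n½» (dealer R90-CS-plan (g0),
hand «hMbd DISCHARGE», 2026-09-04T16:14:01Z), h413 = `stmt-HodgeConjecture-24833`: the INTERTWINED PART of the Borel constant term of a LEVEL-`K′` Eisenstein series of
`U(1,1)_{L∕L⁺}` is BOUNDED HIGH IN THE CUSP (`Re z > 1`, `{T < H}`, `T > 0`) — the letter `hMbd` of the T2-(iii) file `K2E1TruncatedEisensteinCuspOrthogonalLevelCMTwo` (R90-CS-p03).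
-/
import Summits.HodgeConjecture.HodgeConjecture.Theorems.K2E1ChiEisensteinConstantTermCMTwo     -- ★ CT unfolding `borelConstantTerm_eisensteinSeriesU_flatSectionU_cm_two` (section-generic); brings ★ `hfin_of_locallyUniformMajorant`, ★ CM majorant, ★ `isInvInvariant_of_isHaarMeasure_two`
import Summits.HodgeConjecture.HodgeConjecture.Theorems.K2E1IntertwiningGrowthU2               -- ★ [D8]₂ `integral_borelHeight_weylLongU_mul_rpow_eq` (GK: `∫ H(w₀vg)^σ = c(σ)·H(g)^{1−σ}`), ★ `integrable_borelHeight_weylLongU_mul_rpow`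
import Literature.NumberTheory.Automorphic.UnitaryGroupIwasawaAdelic                           -- ★ `exists_mem_borelAdelic_mul_mem_standardMaximalCompactGL_cm` (Iwasawa `G = B·K` at the CM pair)
import HarnessLib

/-!
# K2·E1 ∕ R90-TF S8 — `K2E1EisensteinConstantTermIntertwinedBoundLevelU2`: THE INTERTWINED PART `E_B(f_z) − f_z` OF THE CONSTANT TERM OF A LEVEL-`K′` EISENSTEIN SERIES OF
# `U(1,1)_{L∕L⁺}` IS BOUNDED ON `{T < H}` (`Re z > 1`, `T > 0`) — the letter `hMbd` of T2-(iii)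

Track B ∕ K2-LIT inside programme R90-TF (brief `director/R90-BRIEF.v2.md` 1f40d54518340a35), section S8 = continuous spectrum ∕ `n = ½` (base `R90-CS`), crux h413 =
`stmt-HodgeConjecture-24833`, route of record `HCCMUnconditional`; cell `hodgecm-mathlib`.  Prover seat `hodgecm-mathlib-R90-C14-p01` (g0), hand «`hMbd` DISCHARGE» of the dealer
R90-CS-plan (g0) (R90 bus 2026-09-04T16:14:01Z (2)); consumer: R90-CS-p03 (g0)'s `Theorems/K2E1TruncatedEisensteinCuspOrthogonalLevelCMTwo.lean` (T2-(iii), Godement-domain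
orthogonality of the truncated level-`K′` Eisenstein series to cusp forms), whose ONE new letter `hMbd` ([MoeglinWaldspurger1995, II.1.7]: «the intertwined part of `E_B` is bounded high
in the cusp») is this file's conclusion token-for-token (ruling S8-R9, supplier-first).  THEOREMS ONLY (no `def`, no `instance`, no notation, no named-fact hypothesis, no `sorry`); lane
`--supports stmt-HodgeConjecture-24833 --as helper` (count-neutral).  Closes no socket.

THE MATHEMATICS ([MoeglinWaldspurger1995, II.1.6–II.1.7]; [Garrett2018, §2.8]; [GindikinKarpelevich1962]).  For a continuous bounded section `φ` (`‖φ‖ ≤ M`) of `U(J₂)(𝔸_{L⁺})`, left-invariant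
under `N(𝔸)` and `B(L⁺)`, and `Re z > 1`, the Borel constant term of `E(f_z)`, `f_z = φ·H^z`, unfolds along the Bruhat decomposition as
`E_B(f_z)(g) = f_z(g) + (ν𝓕)⁻¹·∫_{N(𝔸)} f_z(w₀ v g) dν(v)` (★ `K2E1ChiEisensteinConstantTermCMTwo.borelConstantTerm_eisensteinSeriesU_flatSectionU_cm_two`, section-generic).  The
big-cell integral is dominated termwise, `|f_z(w₀ v g)| ≤ M·H(w₀ v g)^{Re z}`, and the spherical standard intertwining integral is computed by Gindikin–Karpelevich ∕ Iwasawa–Levi: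
`∫_{N(𝔸)} H(w₀ v g)^σ dν(v) = c(σ)·H(g)^{1−σ}`, `c(σ) = ∫_{N(𝔸)} H(w₀ v)^σ dν(v) < ∞` for `σ = Re z > 1` (★ [D8]₂ `K2E1IntertwiningGrowthU2.integral_borelHeight_weylLongU_mul_rpow_eq`, finiteness ★
`integrable_borelHeight_weylLongU_mul_rpow` from the Godement finiteness of the standard section, ★ `hfin_of_locallyUniformMajorant` ∘ ★ `exists_locallyUniform_majorant_flatSectionU_cm_two`).
Hence `‖E_B(f_z)(g) − f_z(g)‖ ≤ (ν𝓕)⁻¹·M·c(Re z)·H(g)^{1−Re z} ≤ (ν𝓕)⁻¹·M·c(Re z)·T^{1−Re z}` whenever `T < H(g)`, because `1 − Re z < 0` and `T > 0` (Mathlib `Real.rpow_le_rpow_of_nonpos`).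
The hypothesis `0 < T` is NECESSARY: at the spherical vector the intertwined part is `(ν𝓕)⁻¹·c(z)φ₀·H(g)^{1−z}`, unbounded as `H(g) → 0`.
* **`exists_bound_norm_borelConstantTerm_sub_flatSectionU_cm_two`** — `∃ C, ∀ g, T < H(g) → ‖E(f_z)_B(g) − f_z(g)‖ ≤ C` (binders = ★ CT unfolding's `ν h𝓕N h𝓕c hφc hφM hφN hφB hz` verbatim,
  then `{T : ℝ≥0} (hT : 0 < T)`).
HONEST LABEL: HC_CM is proved only modulo the 7 printed citations (2 remaining named inputs: hLiu418 = `stmt-HodgeConjecture-24832`, h413 = `stmt-HodgeConjecture-24833`) until rung 0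
closes; this file asserts no named fact and closes no socket; it is unconditional (no letters).
References: [MoeglinWaldspurger1995] C. Mœglin, J.-L. Waldspurger, *Spectral Decomposition and Eisenstein Series* (1995), II.1.6–II.1.7 · [Garrett2018] P. Garrett, *Modern Analysis of
Automorphic Forms by Example* 1 (2018), §2.8 · [Rogawski1990] §2.2 · [Godement1964] §1.1.
-/

set_option autoImplicit false
-- the mandated namespace repeats the single-problem summit's segment (`HodgeConjecture.HodgeConjecture`)
set_option linter.dupNamespace false

noncomputable section

open MeasureTheory Measure NumberField IsDedekindDomain Set Filter
open scoped ENNReal NNReal Topology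
open Literature.NumberTheory.Automorphic Literature.NumberTheory.Automorphic.UnitaryGroup AdelicGroupData
open Summit.HodgeConjecture.HodgeConjecture.Cruxes.H413.K2E1BorelEisensteinU
open Summit.HodgeConjecture.HodgeConjecture.Cruxes.H413.K2E1EisensteinAnalyticBinders (hfin_of_locallyUniformMajorant)
open Summit.HodgeConjecture.HodgeConjecture.Cruxes.H413.K2E1BorelEisensteinGodementCMTwo (exists_locallyUniform_majorant_flatSectionU_cm_two)
open Summit.HodgeConjecture.HodgeConjecture.Cruxes.H413.K2E1UnipotentHaarNormalisationU2 (isInvInvariant_of_isHaarMeasure_two)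
open Summit.HodgeConjecture.HodgeConjecture.Cruxes.H413.K2E1BorelCosetsDictionary (forall_arithmeticBorel_iff)
open Summit.HodgeConjecture.HodgeConjecture.Cruxes.H413.K2E1ChiEisensteinConstantTermCMTwo (borelConstantTerm_eisensteinSeriesU_flatSectionU_cm_two)
open Summit.HodgeConjecture.HodgeConjecture.Cruxes.H413.K2E1IntertwiningGrowthU2 (integral_borelHeight_weylLongU_mul_rpow_eq integrable_borelHeight_weylLongU_mul_rpow)

namespace Summit.HodgeConjecture.HodgeConjecture.Cruxes.H413.K2E1EisensteinConstantTermIntertwinedBoundLevelU2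

variable (L : Type) [Field L] [NumberField L] [IsCMField L]
variable [MeasurableSpace (quasiSplit (↥(maximalRealSubfield L)) L (IsCMField.complexConj L) 2).Adelic] [BorelSpace (quasiSplit (↥(maximalRealSubfield L)) L (IsCMField.complexConj L) 2).Adelic]

/-- **THE INTERTWINED PART OF THE CONSTANT TERM OF A LEVEL-`K′` EISENSTEIN SERIES IS BOUNDED HIGH IN THE CUSP** (`U(1,1)_{L∕L⁺}`; the letter `hMbd` of T2-(iii)): for a Haar measure
`ν` of `N(𝔸_{L⁺})`, a fundamental domain `𝓕` of `N(L⁺)` with compact closure, a CONTINUOUS BOUNDED section `φ` (`‖φ‖ ≤ M`) left-invariant under `N(𝔸_{L⁺})` and `B(L⁺)`, `1 < Re z` and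
`0 < T`: there is `C` with `‖E(f_z)_B(g) − f_z(g)‖ ≤ C` for every `g` with `T < H(g)` (`f_z = φ·H^z`).  Proof: Bruhat unfolding ★ `E_B(f_z) = f_z + (ν𝓕)⁻¹·∫_{N(𝔸)} f_z(w₀ v ·) dν`,
`|f_z(w₀vg)| ≤ M·H(w₀vg)^{Re z}`, Gindikin–Karpelevich ★ `∫ H(w₀vg)^σ dν = c(σ)H(g)^{1−σ}` (`c(σ) < ∞` ★), and `H(g)^{1−Re z} ≤ T^{1−Re z}`; `C = (ν𝓕)⁻¹·M·c(Re z)·T^{1−Re z}`.  (`0 < T` is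
necessary: the intertwined part of the spherical series is `∝ H(g)^{1−z}`, unbounded as `H(g) → 0`.) [cite: MoeglinWaldspurger1995, II.1.6–II.1.7] [cite: Garrett2018, §2.8] -/
theorem exists_bound_norm_borelConstantTerm_sub_flatSectionU_cm_two (ν : Measure ↥(adelicUnipotent (↥(maximalRealSubfield L)) L (IsCMField.complexConj L) 2)) [ν.IsHaarMeasure]
    {𝓕 : Set ↥(adelicUnipotent (↥(maximalRealSubfield L)) L (IsCMField.complexConj L) 2)} (h𝓕N : IsFundamentalDomain ↥(rationalUnipotent (↥(maximalRealSubfield L)) L (IsCMField.complexConj L) 2) 𝓕 ν) (h𝓕c : IsCompact (closure 𝓕))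
    {φ : (quasiSplit (↥(maximalRealSubfield L)) L (IsCMField.complexConj L) 2).Adelic → ℂ} (hφc : Continuous φ) {M : ℝ} (hφM : ∀ x, ‖φ x‖ ≤ M)
    (hφN : ∀ (n : ↥(adelicUnipotent (↥(maximalRealSubfield L)) L (IsCMField.complexConj L) 2)) (y : (quasiSplit (↥(maximalRealSubfield L)) L (IsCMField.complexConj L) 2).Adelic),
      φ ((n : (quasiSplit (↥(maximalRealSubfield L)) L (IsCMField.complexConj L) 2).Adelic) * y) = φ y)
    (hφB : ∀ b ∈ borelU ((IsCMField.complexConj L : L ≃ₐ[↥(maximalRealSubfield L)] L) : L →+* L) ((StdForm.antidiagonal 2).over L), ∀ x : (quasiSplit (↥(maximalRealSubfield L)) L (IsCMField.complexConj L) 2).Adelic,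
      φ ((quasiSplit (↥(maximalRealSubfield L)) L (IsCMField.complexConj L) 2).toAdelic b * x) = φ x)
    {z : ℂ} (hz : 1 < z.re) {T : ℝ≥0} (hT : 0 < T) :
    ∃ C : ℝ, ∀ g : (quasiSplit (↥(maximalRealSubfield L)) L (IsCMField.complexConj L) 2).Adelic, T < borelHeight g →
      ‖borelConstantTerm ν 𝓕 (eisensteinSeriesU (flatSectionU φ z)) g - flatSectionU φ z g‖ ≤ C := by
  haveI := t2Space_adeleRing_of_numberField L
  haveI := locallyCompactSpace_adeleRing' L
  haveI : T2Space (quasiSplit (↥(maximalRealSubfield L)) L (IsCMField.complexConj L) 2).Adelic := inferInstanceAs (T2Space (adelic (↥(maximalRealSubfield L)) L (IsCMField.complexConj L) 2 ((StdForm.antidiagonal 2).over L)))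
  haveI : ν.IsInvInvariant := isInvInvariant_of_isHaarMeasure_two ν
  have hc : IsCMField.complexConj L * IsCMField.complexConj L = 1 := AlgEquiv.ext fun x => IsCMField.complexConj_apply_apply L x
  have hc1 : IsCMField.complexConj L ≠ 1 := IsCMField.complexConj_ne_one L
  have hBK := exists_mem_borelAdelic_mul_mem_standardMaximalCompactGL_cm L (N := 2)
  have hMnn : 0 ≤ M := (norm_nonneg _).trans (hφM 1)
  -- `c(Re z) = ∫_{N(𝔸)} H(w₀ v)^{Re z} dν(v) ≥ 0`
  have hcnn : 0 ≤ ∫ v : ↥(adelicUnipotent (↥(maximalRealSubfield L)) L (IsCMField.complexConj L) 2),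
      (borelHeight ((quasiSplit (↥(maximalRealSubfield L)) L (IsCMField.complexConj L) 2).toAdelic (weylLongU ((IsCMField.complexConj L : L ≃ₐ[↥(maximalRealSubfield L)] L) : L →+* L) (rfl : (StdForm.antidiagonal 2).over L = (StdForm.antidiagonal 2).over L)) *
        (v : (quasiSplit (↥(maximalRealSubfield L)) L (IsCMField.complexConj L) 2).Adelic)) : ℝ) ^ z.re ∂ν :=
    integral_nonneg fun v => Real.rpow_nonneg (NNReal.coe_nonneg _) _
  refine ⟨(ν 𝓕).toReal⁻¹ * (M * ((∫ v : ↥(adelicUnipotent (↥(maximalRealSubfield L)) L (IsCMField.complexConj L) 2),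
      (borelHeight ((quasiSplit (↥(maximalRealSubfield L)) L (IsCMField.complexConj L) 2).toAdelic (weylLongU ((IsCMField.complexConj L : L ≃ₐ[↥(maximalRealSubfield L)] L) : L →+* L) (rfl : (StdForm.antidiagonal 2).over L = (StdForm.antidiagonal 2).over L)) *
        (v : (quasiSplit (↥(maximalRealSubfield L)) L (IsCMField.complexConj L) 2).Adelic)) : ℝ) ^ z.re ∂ν) * (T : ℝ) ^ (1 - z.re))), fun g hTg => ?_⟩
  have hHpos : (0 : ℝ) < (borelHeight g : ℝ) := by exact_mod_cast borelHeight_pos g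
  have hTpos : (0 : ℝ) < (T : ℝ) := by exact_mod_cast hT
  have hTle : (T : ℝ) ≤ (borelHeight g : ℝ) := by exact_mod_cast hTg.le
  -- Godement finiteness of the standard section `H^z` at `g`, hence `v ↦ H(w₀ v g)^{Re z} ∈ L¹(ν)`
  have hfB1 : ∀ b ∈ borelU ((IsCMField.complexConj L : L ≃ₐ[↥(maximalRealSubfield L)] L) : L →+* L) ((StdForm.antidiagonal 2).over L), ∀ x : (quasiSplit (↥(maximalRealSubfield L)) L (IsCMField.complexConj L) 2).Adelic,
      flatSectionU (fun _ : (quasiSplit (↥(maximalRealSubfield L)) L (IsCMField.complexConj L) 2).Adelic => (1 : ℂ)) z ((quasiSplit (↥(maximalRealSubfield L)) L (IsCMField.complexConj L) 2).toAdelic b * x) =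
        flatSectionU (fun _ : (quasiSplit (↥(maximalRealSubfield L)) L (IsCMField.complexConj L) 2).Adelic => (1 : ℂ)) z x :=
    forall_arithmeticBorel_iff.1 fun b hb x => by rw [flatSectionU_apply, flatSectionU_apply, K2E1TruncatedEisensteinExplicit.borelHeight_arithmeticBorel_mul hb]
  have hfin := hfin_of_locallyUniformMajorant ν hfB1 (fun q => (continuous_flatSectionU continuous_const z).comp (continuous_const.mul continuous_id))
    (exists_locallyUniform_majorant_flatSectionU_cm_two L hz (φ := fun _ : (quasiSplit (↥(maximalRealSubfield L)) L (IsCMField.complexConj L) 2).Adelic => (1 : ℂ)) (M := ‖(1 : ℂ)‖) (fun x => le_rfl)) h𝓕c g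
  have hI := integrable_borelHeight_weylLongU_mul_rpow ν h𝓕N z g hfin
  -- `|f_z(w₀ v g)| ≤ M · H(w₀ v g)^{Re z}`
  have hle : ∀ v : ↥(adelicUnipotent (↥(maximalRealSubfield L)) L (IsCMField.complexConj L) 2),
      ‖flatSectionU φ z ((quasiSplit (↥(maximalRealSubfield L)) L (IsCMField.complexConj L) 2).toAdelic (weylLongU ((IsCMField.complexConj L : L ≃ₐ[↥(maximalRealSubfield L)] L) : L →+* L) (rfl : (StdForm.antidiagonal 2).over L = (StdForm.antidiagonal 2).over L)) *
        ((v : (quasiSplit (↥(maximalRealSubfield L)) L (IsCMField.complexConj L) 2).Adelic) * g))‖ ≤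
        M * (borelHeight ((quasiSplit (↥(maximalRealSubfield L)) L (IsCMField.complexConj L) 2).toAdelic (weylLongU ((IsCMField.complexConj L : L ≃ₐ[↥(maximalRealSubfield L)] L) : L →+* L) (rfl : (StdForm.antidiagonal 2).over L = (StdForm.antidiagonal 2).over L)) *
          ((v : (quasiSplit (↥(maximalRealSubfield L)) L (IsCMField.complexConj L) 2).Adelic) * g)) : ℝ) ^ z.re := fun v => by
    have hp : (0 : ℝ) < (borelHeight ((quasiSplit (↥(maximalRealSubfield L)) L (IsCMField.complexConj L) 2).toAdelic (weylLongU ((IsCMField.complexConj L : L ≃ₐ[↥(maximalRealSubfield L)] L) : L →+* L) (rfl : (StdForm.antidiagonal 2).over L = (StdForm.antidiagonal 2).over L)) *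
        ((v : (quasiSplit (↥(maximalRealSubfield L)) L (IsCMField.complexConj L) 2).Adelic) * g)) : ℝ) := by exact_mod_cast borelHeight_pos _
    rw [flatSectionU_apply, norm_mul, Complex.norm_cpow_eq_rpow_re_of_pos hp]
    exact mul_le_mul_of_nonneg_right (hφM _) (Real.rpow_nonneg hp.le _)
  -- `‖∫ f_z(w₀ v g) dν‖ ≤ M · c(Re z) · H(g)^{1 − Re z}` (Gindikin–Karpelevich ★)
  have hM : ‖∫ v : ↥(adelicUnipotent (↥(maximalRealSubfield L)) L (IsCMField.complexConj L) 2),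
      flatSectionU φ z ((quasiSplit (↥(maximalRealSubfield L)) L (IsCMField.complexConj L) 2).toAdelic (weylLongU ((IsCMField.complexConj L : L ≃ₐ[↥(maximalRealSubfield L)] L) : L →+* L) (rfl : (StdForm.antidiagonal 2).over L = (StdForm.antidiagonal 2).over L)) *
        ((v : (quasiSplit (↥(maximalRealSubfield L)) L (IsCMField.complexConj L) 2).Adelic) * g)) ∂ν‖ ≤
      M * ((∫ v : ↥(adelicUnipotent (↥(maximalRealSubfield L)) L (IsCMField.complexConj L) 2),
        (borelHeight ((quasiSplit (↥(maximalRealSubfield L)) L (IsCMField.complexConj L) 2).toAdelic (weylLongU ((IsCMField.complexConj L : L ≃ₐ[↥(maximalRealSubfield L)] L) : L →+* L) (rfl : (StdForm.antidiagonal 2).over L = (StdForm.antidiagonal 2).over L)) *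
          (v : (quasiSplit (↥(maximalRealSubfield L)) L (IsCMField.complexConj L) 2).Adelic)) : ℝ) ^ z.re ∂ν) * (borelHeight g : ℝ) ^ (1 - z.re)) := by
    rw [← integral_borelHeight_weylLongU_mul_rpow_eq hc hc1 ν hBK z.re g, ← integral_const_mul]
    exact norm_integral_le_of_norm_le (hI.const_mul M) (Eventually.of_forall hle)
  -- the Bruhat-unfolded constant term ★ and the height bound `H(g)^{1−Re z} ≤ T^{1−Re z}`
  rw [borelConstantTerm_eisensteinSeriesU_flatSectionU_cm_two L ν h𝓕N h𝓕c hφc hφM hφN hφB hz g, add_sub_cancel_left, norm_smul, Real.norm_eq_abs,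
    abs_of_nonneg (inv_nonneg.2 ENNReal.toReal_nonneg)]
  simp_rw [mul_assoc ((quasiSplit (↥(maximalRealSubfield L)) L (IsCMField.complexConj L) 2).toAdelic (weylLongU ((IsCMField.complexConj L : L ≃ₐ[↥(maximalRealSubfield L)] L) : L →+* L) (rfl : (StdForm.antidiagonal 2).over L = (StdForm.antidiagonal 2).over L)))]
  refine mul_le_mul_of_nonneg_left (hM.trans ?_) (inv_nonneg.2 ENNReal.toReal_nonneg)
  refine mul_le_mul_of_nonneg_left (mul_le_mul_of_nonneg_left ?_ hcnn) hMnn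
  exact Real.rpow_le_rpow_of_nonpos hTpos hTle (by linarith)

end Summit.HodgeConjecture.HodgeConjecture.Cruxes.H413.K2E1EisensteinConstantTermIntertwinedBoundLevelU2

end
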